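import Summits.MatrixMultiplication.MatrixMultiplication.Theorems.SoloInformedCwTwoBoundaryAlgebras
import HarnessLib

/-!
# `T_{U₂}`, `T_{B_{0,1}}` and `T_{ℂ[x,y]/𝔪²}` are (factor-permuted) Nurmiev normal forms (solo-informed, gen 25)

Eighth file of the §2n series, companion of `SoloInformedCwTwoIsomorphisms`: order-`0` `DegenCert`
certificates (constant invertible integer matrices, both directions) identifying three more named
tensors with literal Nurmiev normal forms (`nurmievInt`, DdGM 2023 Table I):

* `tTwo_iso_nurmiev_11` : `T₂^{(201)} ≅ N₁₁`, where `T₂ = T_{U₂}` is the square-dropping / upper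
  triangular tensor of `SoloInformedTTwoSquare` (`R̲ = 4`, `R̃ ≤ √14`) and `T^{(201)}(a,b,c) = T(b,c,a)`;
* `unitalIdem_one_iso_nurmiev_11` : `T_{B_{0,1}}^{(201)} ≅ N₁₁` (so `B_{0,1} ≅ U₂` as tensors, as
  claimed in `SoloInformedCwTwoBoundaryAlgebras`);
* `nullAlg_iso_nurmiev_14` : `T_{ℂ[x,y]/𝔪²}^{(102)} ≅ N₁₄`.

The isomorphisms were found by the exact pencil-cubic + Sylvester solver of the isomorphisms file,
run against a factor of the target whose slice pencil is generically invertible (for `N₁₁` and `N₁₄`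
the first-factor pencil is identically singular).  Each statement is `PolyDegeneratesTo` both ways
over `ℂ` (multipliers `2/2`, `2/4`, `1/4`).
-/

namespace Summit.MatrixMultiplication.MatrixMultiplication.Theorems

open Literature.Computability.AlgebraicComplexity
open Literature.Barriers.MatrixMultiplication (PolyDegeneratesTo)

/-- `T₂^{(201)} ≅ N₁₁` (`T₂ = T_{U₂}`, upper triangular `2 × 2` matrices; factors cycled) — forward
certificate (order `0`, multiplier `2`). -/
theorem tTwo_iso_nurmiev_11_check :
    DegenCert.check 3 3 3 3 3 3 0 2 (fun a b c => tTwoInt b c a) (nurmievInt 11)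
      ![![[1], [2], []], ![[-1], [], []], ![[1], [], [-1]]]
      ![![[-1], [], []], ![[-1], [-1], [-1]], ![[], [-1], []]]
      ![![[], [-1], []], ![[-2], [-1], [2]], ![[2], [], []]] = true := by
  decide +kernel

/-- Backward certificate (order `0`, multiplier `2`). -/
theorem nurmiev_11_iso_tTwo_check :
    DegenCert.check 3 3 3 3 3 3 0 2 (nurmievInt 11) (fun a b c => tTwoInt b c a)
      ![![[], [1], []], ![[2], [], []], ![[], [-1], [1]]]
      ![![[-1], [], []], ![[], [], [-1]], ![[-1], [-1], [-1]]]
      ![![[], [], [-2]], ![[-1], [], []], ![[], [-2], [2]]] = true := by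
  decide +kernel

/-- `T_{B_{0,1}}^{(201)} ≅ N₁₁` — forward certificate (order `0`, multiplier `2`). -/
theorem unitalIdem_one_iso_nurmiev_11_check :
    DegenCert.check 3 3 3 3 3 3 0 2 (fun a b c => unitalIdemInt 1 b c a) (nurmievInt 11)
      ![![[-2], [2], [-1]], ![[1], [], [-1]], ![[-1], [], []]]
      ![![[-1], [], []], ![[1], [-1], []], ![[-1], [-1], [-1]]]
      ![![[], [-1], []], ![[2], [1], []], ![[-2], [3], [2]]] = true := by
  decide +kernel

/-- Backward certificate (order `0`, multiplier `4`). -/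
theorem nurmiev_11_iso_unitalIdem_one_check :
    DegenCert.check 3 3 3 3 3 3 0 4 (nurmievInt 11) (fun a b c => unitalIdemInt 1 b c a)
      ![![[], [], [-2]], ![[-2], [2], [1]], ![[], [-2], [2]]]
      ![![[-1], [], []], ![[-1], [-1], []], ![[-1], [-1], [-1]]]
      ![![[2], [2], []], ![[2], [], []], ![[1], [], [2]]] = true := by
  decide +kernel

/-- `T_{ℂ[x,y]/𝔪²}^{(102)} ≅ N₁₄` (first two factors swapped) — forward certificate (order `0`,
multiplier `1`). -/
theorem nullAlg_iso_nurmiev_14_check :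
    DegenCert.check 3 3 3 3 3 3 0 1 (fun a b c => nullAlgInt b a c) (nurmievInt 14)
      ![![[-1], [], []], ![[-1], [-1], [-1]], ![[-1], [-1], []]]
      ![![[-1], [], []], ![[2], [-1], [-1]], ![[2], [-1], []]]
      ![![[1], [], [1]], ![[], [1], []], ![[1], [-1], []]] = true := by
  decide +kernel

/-- Backward certificate (order `0`, multiplier `4`). -/
theorem nurmiev_14_iso_nullAlg_check :
    DegenCert.check 3 3 3 3 3 3 0 4 (nurmievInt 14) (fun a b c => nullAlgInt b a c)
      ![![[-1], [], []], ![[-1], [-1], [-1]], ![[-1], [-1], []]]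
      ![![[2], [], []], ![[1], [2], [2]], ![[1], [2], []]]
      ![![[], [], [-2]], ![[], [-2], [2]], ![[-2], [3], []]] = true := by
  decide +kernel

/-- **`T₂^{(201)} ≅ N₁₁`** over `ℂ`: degenerations both ways. -/
theorem tTwo_iso_nurmiev_11 :
    PolyDegeneratesTo (fun a b c => tTwo ℂ b c a) (nurmiev ℂ 11) ∧
      PolyDegeneratesTo (nurmiev ℂ 11) (fun a b c => tTwo ℂ b c a) :=
  ⟨DegenCert.polyDegeneratesTo_of_check ℂ tTwo_iso_nurmiev_11_check
      (isUnit_iff_ne_zero.mpr (by norm_num)),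
    DegenCert.polyDegeneratesTo_of_check ℂ nurmiev_11_iso_tTwo_check
      (isUnit_iff_ne_zero.mpr (by norm_num))⟩

/-- **`T_{B_{0,1}}^{(201)} ≅ N₁₁`** over `ℂ`. -/
theorem unitalIdem_one_iso_nurmiev_11 :
    PolyDegeneratesTo (fun a b c => unitalIdem ℂ 1 b c a) (nurmiev ℂ 11) ∧
      PolyDegeneratesTo (nurmiev ℂ 11) (fun a b c => unitalIdem ℂ 1 b c a) :=
  ⟨DegenCert.polyDegeneratesTo_of_check ℂ unitalIdem_one_iso_nurmiev_11_check
      (isUnit_iff_ne_zero.mpr (by norm_num)),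
    DegenCert.polyDegeneratesTo_of_check ℂ nurmiev_11_iso_unitalIdem_one_check
      (isUnit_iff_ne_zero.mpr (by norm_num))⟩

/-- **`T_{ℂ[x,y]/𝔪²}^{(102)} ≅ N₁₄`** over `ℂ`. -/
theorem nullAlg_iso_nurmiev_14 :
    PolyDegeneratesTo (fun a b c => nullAlg ℂ b a c) (nurmiev ℂ 14) ∧
      PolyDegeneratesTo (nurmiev ℂ 14) (fun a b c => nullAlg ℂ b a c) :=
  ⟨DegenCert.polyDegeneratesTo_of_check ℂ nullAlg_iso_nurmiev_14_check
      (isUnit_iff_ne_zero.mpr (by norm_num)),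
    DegenCert.polyDegeneratesTo_of_check ℂ nurmiev_14_iso_nullAlg_check
      (isUnit_iff_ne_zero.mpr (by norm_num))⟩

/-- Corollary: `T₂` (cycled) and `T_{B_{0,1}}` (cycled) degenerate to each other — the tensor-level
isomorphism `B_{0,1} ≅ U₂`. -/
theorem tTwo_degen_unitalIdem_one :
    PolyDegeneratesTo (fun a b c => tTwo ℂ b c a) (fun a b c => unitalIdem ℂ 1 b c a) ∧
      PolyDegeneratesTo (fun a b c => unitalIdem ℂ 1 b c a) (fun a b c => tTwo ℂ b c a) :=
  ⟨tTwo_iso_nurmiev_11.1.trans unitalIdem_one_iso_nurmiev_11.2,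
    unitalIdem_one_iso_nurmiev_11.1.trans tTwo_iso_nurmiev_11.2⟩

end Summit.MatrixMultiplication.MatrixMultiplication.Theorems
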